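import Literature.Analysis.Distribution.ConeCutoffEstimates
import Literature.Analysis.Distribution.SmoothCutoff
import Mathlib.Analysis.Distribution.SchwartzSpace.Fourier
import HarnessLib

/-!
# The Fourier–Laplace transform of a tempered distribution with spectrum in a cone: definitions

Topic `Literature/Analysis/Distribution`. Third brick of the proof of
`fourierLaplace_coneSupport` (`FourierLaplaceCone`; Hörmander Thm. 7.4.2, Streater–Wightman
Thms. 2-6–2-9). For a continuous linear functional `T` on `𝓢(ℝ^ι, ℂ)` and a set `S ⊆ ℝ^ι` we
define

* `fourierInvDual T = T ∘ 𝓕⁻¹` (the tempered distribution `u` with `𝓕u = T`; under the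
  hypothesis of the fact, `u` is supported in `S`);
* `coneCutoff S` — a chosen smooth cutoff `χ` with all derivatives bounded
  (`coneCutoffBound S n` bounds `‖Dⁱχ‖`, `i ≤ n`), `χ = 1` on `thickening 1 S` and
  `tsupport χ ⊆ thickening 3 S` (`exists_smooth_cutoff`, Hörmander Thm. 1.4.1);
* `imVec z`, the imaginary part of `z ∈ ℂ^ι` in `ℝ^ι`, and `expForm z`, the continuous `ℝ`-linear form `ξ ↦ −2πi ∑ᵢ zᵢ ξᵢ` on `ℝ^ι` (`Re = 2π⟪Im z, ·⟫`);
* `laplaceKernelFun S z ξ = χ(ξ) e^{−2πi⟨z, ξ⟩}` and the Schwartz function `laplaceKernel S z` it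
  defines when `Im z` lies in the open cone `C = interior S⁻` (`0` otherwise) — Streater–Wightman's
  test function "`(2π)^{-2n} a(p, tη) e^{−tp·ξ}`" of the proof of Thm. 2-10 / eq. (2-81);
* `fourierLaplaceFun T S z = u(laplaceKernel S z)`, the Fourier–Laplace transform
  `⟨u, e^{−2πi⟨·, z⟩}⟩` (Hörmander (7.4.3) with Mathlib's `2π` normalisation).

and prove the basic estimate behind everything else: on `{Im z ∈ M}`, `M` a compact subset of
`C`, all derivatives of the kernel are `O_n((1 + ‖z‖)ⁿ e^{−c‖ξ‖})` uniformly
(`exists_kernel_bound`), so that the Schwartz seminorms of `laplaceKernel S z` grow polynomially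
in `z` (`exists_seminorm_laplaceKernel_le`). Holomorphy, polynomial bounds and boundary values of
`fourierLaplaceFun` follow in the sibling files.

## References

* L. Hörmander, *The Analysis of Linear Partial Differential Operators I*, 2nd ed., §7.4,
  Thm. 7.4.2, eq. (7.4.3). [HormanderALPDO1]
* R. F. Streater, A. S. Wightman, *PCT, Spin and Statistics, and All That*, §2-3, Thms. 2-6,
  2-9, 2-10, eqs. (2-62), (2-81). [StreaterWightman1964]
-/

noncomputable section

open Set Filter Metric SchwartzMap
open _root_.Complex (exp I)
open scoped ContDiff Topology RealInnerProductSpace SchwartzMap FourierTransform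

namespace Literature.Analysis.Distribution

variable {ι : Type*}

/-! ### Imaginary parts of complex points -/

/-- The imaginary part of `z ∈ ℂ^ι` as a point of `ℝ^ι`. [folklore] -/
def imVec (z : ι → ℂ) : EuclideanSpace ℝ ι := WithLp.toLp 2 fun i => (z i).im

/-- Components of `imVec`. [folklore] -/
@[simp]
theorem imVec_apply (z : ι → ℂ) (i : ι) : imVec z i = (z i).im := rfl

/-- `imVec` is additive. [folklore] -/
theorem imVec_add (z w : ι → ℂ) : imVec (z + w) = imVec z + imVec w := by
  ext i; simp

/-- The imaginary part of the ray point `x + ity` is `t y`. [folklore] -/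
theorem imVec_rayPoint (x y : EuclideanSpace ℝ ι) (t : ℝ) : imVec (rayPoint x y t) = t • y := by
  ext i; simp [rayPoint]

variable [Fintype ι]

/-- `‖Im w‖₂ ≤ √|ι| ‖w‖_∞`. [folklore] -/
theorem norm_imVec_le (w : ι → ℂ) : ‖imVec w‖ ≤ Real.sqrt (Fintype.card ι) * ‖w‖ := by
  rw [EuclideanSpace.norm_eq]
  have h : ∑ i, ‖imVec w i‖ ^ 2 ≤ Fintype.card ι * ‖w‖ ^ 2 := by
    calc ∑ i, ‖imVec w i‖ ^ 2 ≤ ∑ _i : ι, ‖w‖ ^ 2 := by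
          refine Finset.sum_le_sum fun i _ => ?_
          rw [imVec_apply]
          have h1 : ‖(w i).im‖ ≤ ‖w i‖ := by
            rw [Real.norm_eq_abs]; exact Complex.abs_im_le_norm _
          have h2 : ‖w i‖ ≤ ‖w‖ := norm_le_pi_norm w i
          gcongr
          exact h1.trans h2
      _ = Fintype.card ι * ‖w‖ ^ 2 := by simp
  calc Real.sqrt (∑ i, ‖imVec w i‖ ^ 2) ≤ Real.sqrt (Fintype.card ι * ‖w‖ ^ 2) :=
        Real.sqrt_le_sqrt h
    _ = Real.sqrt (Fintype.card ι) * ‖w‖ := by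
        rw [Real.sqrt_mul (Nat.cast_nonneg _), Real.sqrt_sq (norm_nonneg _)]

/-! ### The exponent linear form -/

/-- The exponent of the Fourier–Laplace kernel as a continuous `ℝ`-linear form on `ℝ^ι`:
`expForm z ξ = −2πi ∑ᵢ zᵢ ξᵢ` (Mathlib's Fourier kernel `e^{−2πi⟪x, ξ⟫}` continued to complex
`x = z`). [folklore] -/
def expForm (z : ι → ℂ) : EuclideanSpace ℝ ι →L[ℝ] ℂ :=
  (-(2 * Real.pi * I)) • ∑ i, z i • (Complex.ofRealCLM.comp (EuclideanSpace.proj (𝕜 := ℝ) i))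

/-- `expForm z ξ = −2πi ∑ᵢ zᵢ ξᵢ`. [folklore] -/
theorem expForm_apply (z : ι → ℂ) (ξ : EuclideanSpace ℝ ι) :
    expForm z ξ = -(2 * Real.pi * I) * ∑ i, z i * (ξ i : ℂ) := by
  simp [expForm]

/-- `expForm` is additive in `z`. [folklore] -/
theorem expForm_add (z w : ι → ℂ) : expForm (z + w) = expForm z + expForm w := by
  ext ξ
  simp [expForm_apply, add_mul, Finset.sum_add_distrib, mul_add]

/-- **`Re (expForm z ξ) = 2π ⟪Im z, ξ⟫`.** [folklore] -/
theorem re_expForm_apply (z : ι → ℂ) (ξ : EuclideanSpace ℝ ι) :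
    (expForm z ξ).re = 2 * Real.pi * ⟪imVec z, ξ⟫ := by
  rw [expForm_apply, PiLp.inner_apply, Finset.mul_sum]
  simp only [neg_mul, Complex.neg_re, Complex.mul_re, Complex.re_sum,
    Complex.mul_im, Complex.ofReal_re, Complex.ofReal_im, Complex.I_re, Complex.I_im,
    Complex.re_ofNat, Complex.im_ofNat, mul_zero, zero_mul, sub_zero, add_zero, mul_one,
    Finset.mul_sum, imVec_apply]
  simp [mul_comm, mul_left_comm, mul_assoc]

/-- For real `x`, `expForm x ξ = −2πi⟪x, ξ⟫` is Mathlib's Fourier phase. [folklore] -/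
theorem expForm_ofReal_apply (x ξ : EuclideanSpace ℝ ι) :
    expForm (fun i => (x i : ℂ)) ξ = ((-2 * Real.pi * ⟪x, ξ⟫ : ℝ) : ℂ) * I := by
  rw [expForm_apply, PiLp.inner_apply]
  simp only [RCLike.inner_apply, conj_trivial]
  push_cast
  rw [Finset.mul_sum, Finset.mul_sum, Finset.sum_mul]
  refine Finset.sum_congr rfl fun i _ => ?_
  ring

/-- On a ray point, `expForm (x + ity) ξ = −2πi⟪x, ξ⟫ + 2πt⟪y, ξ⟫`. [folklore] -/
theorem expForm_rayPoint_apply (x y ξ : EuclideanSpace ℝ ι) (t : ℝ) :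
    expForm (rayPoint x y t) ξ =
      ((-2 * Real.pi * ⟪x, ξ⟫ : ℝ) : ℂ) * I + ((2 * Real.pi * t * ⟪y, ξ⟫ : ℝ) : ℂ) := by
  rw [expForm_apply, PiLp.inner_apply, PiLp.inner_apply]
  simp only [RCLike.inner_apply, conj_trivial, rayPoint_apply]
  push_cast
  rw [Finset.mul_sum, Finset.mul_sum, Finset.sum_mul, Finset.mul_sum, ← Finset.sum_add_distrib]
  refine Finset.sum_congr rfl fun i _ => ?_
  apply Complex.ext
  · simp
    ring
  · simp
    ring

/-- **`‖expForm z‖ ≤ 2π |ι| ‖z‖`.** [folklore] -/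
theorem norm_expForm_le (z : ι → ℂ) : ‖expForm z‖ ≤ 2 * Real.pi * Fintype.card ι * ‖z‖ := by
  refine ContinuousLinearMap.opNorm_le_bound _ (by positivity) fun ξ => ?_
  rw [expForm_apply, norm_mul, norm_neg]
  have h1 : ‖(2 * Real.pi * I : ℂ)‖ = 2 * Real.pi := by
    simp [abs_of_pos Real.pi_pos]
  rw [h1]
  have h2 : ‖∑ i, z i * (ξ i : ℂ)‖ ≤ Fintype.card ι * (‖z‖ * ‖ξ‖) := by
    calc ‖∑ i, z i * (ξ i : ℂ)‖ ≤ ∑ i, ‖z i * (ξ i : ℂ)‖ := norm_sum_le _ _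
      _ ≤ ∑ _i : ι, ‖z‖ * ‖ξ‖ := by
          refine Finset.sum_le_sum fun i _ => ?_
          rw [norm_mul, Complex.norm_real]
          exact mul_le_mul (norm_le_pi_norm z i) (PiLp.norm_apply_le ξ i) (norm_nonneg _)
            (norm_nonneg _)
      _ = Fintype.card ι * (‖z‖ * ‖ξ‖) := by simp
  calc 2 * Real.pi * ‖∑ i, z i * (ξ i : ℂ)‖ ≤ 2 * Real.pi * (Fintype.card ι * (‖z‖ * ‖ξ‖)) := by
        gcongr
    _ = 2 * Real.pi * Fintype.card ι * ‖z‖ * ‖ξ‖ := by ring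

/-! ### The cutoff attached to a set -/

/-- **A smooth cutoff for `S` with bounded derivatives** (`exists_smooth_cutoff` with `δ = 1`,
the bounds made monotone in the order): `χ ∈ C^∞`, `χ = 1` on `thickening 1 S`,
`tsupport χ ⊆ thickening 3 S`, `‖Dⁱχ‖ ≤ C n` for `i ≤ n`. [cite: HormanderALPDO1, Thm 1.4.1] -/
theorem exists_coneCutoff (S : Set (EuclideanSpace ℝ ι)) :
    ∃ χ : EuclideanSpace ℝ ι → ℝ, ContDiff ℝ ∞ χ ∧ (∀ x ∈ thickening 1 S, χ x = 1) ∧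
      tsupport χ ⊆ thickening 3 S ∧
      ∃ C : ℕ → ℝ, ∀ n, ∀ i ≤ n, ∀ x, ‖iteratedFDeriv ℝ i χ x‖ ≤ C n := by
  obtain ⟨χ, hχ, -, -, h1, hsupp, hb⟩ := exists_smooth_cutoff S one_pos
  choose C₀ hC₀ using hb
  refine ⟨χ, hχ, h1, by simpa using hsupp, fun n => ∑ i ∈ Finset.range (n + 1), |C₀ i|,
    fun n i hi x => ?_⟩
  calc ‖iteratedFDeriv ℝ i χ x‖ ≤ |C₀ i| := (hC₀ i x).trans (le_abs_self _)
    _ ≤ ∑ j ∈ Finset.range (n + 1), |C₀ j| :=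
        Finset.single_le_sum (f := fun j => |C₀ j|) (fun _ _ => abs_nonneg _)
          (Finset.mem_range.2 (Nat.lt_succ_of_le hi))

/-- The chosen cutoff `χ_S`. [folklore] -/
def coneCutoff (S : Set (EuclideanSpace ℝ ι)) : EuclideanSpace ℝ ι → ℝ :=
  (exists_coneCutoff S).choose

/-- The chosen monotone derivative bounds of `χ_S`: `‖Dⁱχ_S‖ ≤ coneCutoffBound S n` for `i ≤ n`.
[folklore] -/
def coneCutoffBound (S : Set (EuclideanSpace ℝ ι)) : ℕ → ℝ :=
  (exists_coneCutoff S).choose_spec.2.2.2.choose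

/-- `χ_S` is smooth. [folklore] -/
theorem contDiff_coneCutoff (S : Set (EuclideanSpace ℝ ι)) : ContDiff ℝ ∞ (coneCutoff S) :=
  (exists_coneCutoff S).choose_spec.1

/-- `χ_S = 1` on `thickening 1 S`. [folklore] -/
theorem coneCutoff_eq_one {S : Set (EuclideanSpace ℝ ι)} {x : EuclideanSpace ℝ ι}
    (hx : x ∈ thickening 1 S) : coneCutoff S x = 1 :=
  (exists_coneCutoff S).choose_spec.2.1 x hx

/-- `tsupport χ_S ⊆ thickening 3 S`. [folklore] -/
theorem tsupport_coneCutoff_subset (S : Set (EuclideanSpace ℝ ι)) :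
    tsupport (coneCutoff S) ⊆ thickening 3 S :=
  (exists_coneCutoff S).choose_spec.2.2.1

/-- `‖Dⁱχ_S(x)‖ ≤ coneCutoffBound S n` for `i ≤ n`. [folklore] -/
theorem norm_iteratedFDeriv_coneCutoff_le (S : Set (EuclideanSpace ℝ ι)) {n i : ℕ} (hi : i ≤ n)
    (x : EuclideanSpace ℝ ι) : ‖iteratedFDeriv ℝ i (coneCutoff S) x‖ ≤ coneCutoffBound S n :=
  (exists_coneCutoff S).choose_spec.2.2.2.choose_spec n i hi x

/-- The bounds are nonnegative. [folklore] -/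
theorem coneCutoffBound_nonneg (S : Set (EuclideanSpace ℝ ι)) (n : ℕ) : 0 ≤ coneCutoffBound S n :=
  (norm_nonneg _).trans (norm_iteratedFDeriv_coneCutoff_le S (Nat.zero_le n) 0)

/-! ### The kernel -/

/-- The kernel function `ξ ↦ χ_S(ξ) e^{−2πi⟨z, ξ⟩}` (Hörmander (1990), (7.4.3); Streater–Wightman
(1964), proof of Thm. 2-10, the test function `a(p, tη) e^{−tp·ξ}`).
[cite: HormanderALPDO1, Thm 7.4.2 eq (7.4.3)] -/
def laplaceKernelFun (S : Set (EuclideanSpace ℝ ι)) (z : ι → ℂ) : EuclideanSpace ℝ ι → ℂ :=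
  fun ξ => (coneCutoff S ξ : ℂ) * exp (expForm z ξ)

/-- Pointwise formula. [folklore] -/
@[simp]
theorem laplaceKernelFun_apply (S : Set (EuclideanSpace ℝ ι)) (z : ι → ℂ) (ξ : EuclideanSpace ℝ ι) :
    laplaceKernelFun S z ξ = (coneCutoff S ξ : ℂ) * exp (expForm z ξ) := rfl

/-- The kernel is smooth. [folklore] -/
theorem contDiff_laplaceKernelFun (S : Set (EuclideanSpace ℝ ι)) (z : ι → ℂ) :
    ContDiff ℝ ∞ (laplaceKernelFun S z) :=
  contDiff_cutoff_cexp (contDiff_coneCutoff S) (expForm z)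

/-- **Exponential decay of the kernel's exponent on the support of the cutoff, uniformly over a
compact set of imaginary parts**: for a compact `M ⊆ interior S⁻` there are `c > 0` and `A` with
`Re (expForm z ξ) ≤ A − c‖ξ‖` for all `z` with `Im z ∈ M` and all `ξ ∈ tsupport χ_S`
(`Re = 2π⟪Im z, ·⟫`, `tsupport χ_S ⊆ thickening 3 S`, and
`exists_forall_inner_le_of_subset_interior_polarCone`). [folklore] -/
theorem exists_re_expForm_le (S : Set (EuclideanSpace ℝ ι)) {M : Set (EuclideanSpace ℝ ι)}
    (hM : IsCompact M) (hMS : M ⊆ interior (polarCone S)) :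
    ∃ c A : ℝ, 0 < c ∧ ∀ z : ι → ℂ, imVec z ∈ M →
      ∀ x ∈ tsupport (coneCutoff S), (expForm z x).re ≤ A - c * ‖x‖ := by
  obtain ⟨r, R, hr, -, -, h⟩ := exists_forall_inner_le_of_subset_interior_polarCone hM hMS
  refine ⟨2 * Real.pi * r, 2 * Real.pi * (3 * (r + R)), by positivity, fun z hz x hx => ?_⟩
  rw [re_expForm_apply]
  have h1 := h (imVec z) hz x (tsupport_coneCutoff_subset S hx)
  have h2 := mul_le_mul_of_nonneg_left h1 (by positivity : (0 : ℝ) ≤ 2 * Real.pi)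
  linarith

/-- **The basic kernel estimate, uniformly over a compact set of imaginary parts**: for a compact
`M ⊆ interior S⁻` there are `c > 0` and `A` such that for every `z` with `Im z ∈ M`,
`‖Dⁿ(laplaceKernelFun S z)(ξ)‖ ≤ 2ⁿ Cₙ (1 + ‖expForm z‖)ⁿ eᴬ e^{−c‖ξ‖}` (`Cₙ = coneCutoffBound S n`).
[folklore] -/
theorem exists_kernel_bound (S : Set (EuclideanSpace ℝ ι)) {M : Set (EuclideanSpace ℝ ι)}
    (hM : IsCompact M) (hMS : M ⊆ interior (polarCone S)) :
    ∃ c A : ℝ, 0 < c ∧ ∀ z : ι → ℂ, imVec z ∈ M → ∀ (n : ℕ) (ξ : EuclideanSpace ℝ ι),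
      ‖iteratedFDeriv ℝ n (laplaceKernelFun S z) ξ‖ ≤
        2 ^ n * coneCutoffBound S n * (1 + ‖expForm z‖) ^ n * Real.exp A *
          Real.exp (-(c * ‖ξ‖)) := by
  obtain ⟨c, A, hc, h⟩ := exists_re_expForm_le S hM hMS
  exact ⟨c, A, hc, fun z hz n ξ => norm_iteratedFDeriv_cutoff_cexp_le (contDiff_coneCutoff S)
    (fun i hi x => norm_iteratedFDeriv_coneCutoff_le S hi x) (expForm z) (h z hz) ξ⟩

/-- The kernel has Schwartz decay when `Im z ∈ interior S⁻`. [folklore] -/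
theorem laplaceKernelFun_decay (S : Set (EuclideanSpace ℝ ι)) {z : ι → ℂ}
    (hz : imVec z ∈ interior (polarCone S)) (k n : ℕ) :
    ∃ C : ℝ, ∀ ξ, ‖ξ‖ ^ k * ‖iteratedFDeriv ℝ n (laplaceKernelFun S z) ξ‖ ≤ C := by
  obtain ⟨c, A, hc, h⟩ := exists_kernel_bound S isCompact_singleton
    (singleton_subset_iff.2 hz)
  refine schwartz_decay_of_exp_bound hc (fun m =>
    ⟨2 ^ m * coneCutoffBound S m * (1 + ‖expForm z‖) ^ m * Real.exp A, 0, fun ξ => ?_⟩) k n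
  simpa using h z (mem_singleton _) m ξ

open Classical in
/-- **The kernel as a Schwartz function**: `laplaceKernel S z = χ_S e^{−2πi⟨z, ·⟩}` when
`Im z ∈ interior S⁻`, and `0` otherwise. [cite: HormanderALPDO1, Thm 7.4.2 eq (7.4.3)] -/
def laplaceKernel (S : Set (EuclideanSpace ℝ ι)) (z : ι → ℂ) : 𝓢(EuclideanSpace ℝ ι, ℂ) :=
  if hz : imVec z ∈ interior (polarCone S) then
    ⟨laplaceKernelFun S z, contDiff_laplaceKernelFun S z, laplaceKernelFun_decay S hz⟩
  else 0

/-- On the tube the Schwartz kernel is the kernel function. [folklore] -/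
theorem coe_laplaceKernel {S : Set (EuclideanSpace ℝ ι)} {z : ι → ℂ}
    (hz : imVec z ∈ interior (polarCone S)) : ⇑(laplaceKernel S z) = laplaceKernelFun S z := by
  rw [laplaceKernel, dif_pos hz]
  rfl

/-- Pointwise form of `coe_laplaceKernel`. [folklore] -/
theorem laplaceKernel_apply {S : Set (EuclideanSpace ℝ ι)} {z : ι → ℂ}
    (hz : imVec z ∈ interior (polarCone S)) (ξ : EuclideanSpace ℝ ι) :
    laplaceKernel S z ξ = (coneCutoff S ξ : ℂ) * exp (expForm z ξ) := by
  rw [coe_laplaceKernel hz, laplaceKernelFun_apply]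

/-- Off the tube the kernel is `0` by definition. [folklore] -/
theorem laplaceKernel_of_notMem {S : Set (EuclideanSpace ℝ ι)} {z : ι → ℂ}
    (hz : imVec z ∉ interior (polarCone S)) : laplaceKernel S z = 0 := by
  rw [laplaceKernel, dif_neg hz]

/-- **Polynomial growth of the kernel's seminorms**: on `{Im z ∈ M}`, `M` compact in the open
cone, `‖laplaceKernel S z‖_{k,n} ≤ D_{k,n} (1 + ‖z‖)ⁿ`. [folklore] -/
theorem exists_seminorm_laplaceKernel_le (S : Set (EuclideanSpace ℝ ι))
    {M : Set (EuclideanSpace ℝ ι)} (hM : IsCompact M) (hMS : M ⊆ interior (polarCone S))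
    (k n : ℕ) :
    ∃ D : ℝ, 0 ≤ D ∧ ∀ z : ι → ℂ, imVec z ∈ M →
      SchwartzMap.seminorm ℂ k n (laplaceKernel S z) ≤ D * (1 + ‖z‖) ^ n := by
  obtain ⟨c, A, hc, h⟩ := exists_kernel_bound S hM hMS
  set κ : ℝ := 2 * Real.pi * Fintype.card ι with hκ
  have hκ0 : 0 ≤ κ := by positivity
  refine ⟨2 ^ n * coneCutoffBound S n * (1 + κ) ^ n * Real.exp A *
      ((k + 0).factorial / c ^ (k + 0) * Real.exp c), by
        have := coneCutoffBound_nonneg S n; positivity, fun z hz => ?_⟩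
  have hzC : imVec z ∈ interior (polarCone S) := hMS hz
  have hb : ∀ ξ, ‖iteratedFDeriv ℝ n (laplaceKernel S z) ξ‖ ≤
      2 ^ n * coneCutoffBound S n * (1 + ‖expForm z‖) ^ n * Real.exp A * (1 + ‖ξ‖) ^ 0 *
        Real.exp (-(c * ‖ξ‖)) := fun ξ => by
    rw [coe_laplaceKernel hzC, pow_zero, mul_one]
    exact h z hz n ξ
  have hC0 : 0 ≤ 2 ^ n * coneCutoffBound S n * (1 + ‖expForm z‖) ^ n * Real.exp A := by
    have := coneCutoffBound_nonneg S n; positivity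
  refine (seminorm_le_of_exp_bound (laplaceKernel S z) hc hC0 hb k).trans ?_
  have hℓ : 1 + ‖expForm z‖ ≤ (1 + κ) * (1 + ‖z‖) := by
    have := norm_expForm_le z
    nlinarith [norm_nonneg z, norm_nonneg (expForm z)]
  have hℓn : (1 + ‖expForm z‖) ^ n ≤ (1 + κ) ^ n * (1 + ‖z‖) ^ n := by
    rw [← mul_pow]; exact pow_le_pow_left₀ (by positivity) hℓ n
  have hCn := coneCutoffBound_nonneg S n
  calc 2 ^ n * coneCutoffBound S n * (1 + ‖expForm z‖) ^ n * Real.exp A *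
        ((k + 0).factorial / c ^ (k + 0) * Real.exp c)
      ≤ 2 ^ n * coneCutoffBound S n * ((1 + κ) ^ n * (1 + ‖z‖) ^ n) * Real.exp A *
        ((k + 0).factorial / c ^ (k + 0) * Real.exp c) := by gcongr
    _ = 2 ^ n * coneCutoffBound S n * (1 + κ) ^ n * Real.exp A *
        ((k + 0).factorial / c ^ (k + 0) * Real.exp c) * (1 + ‖z‖) ^ n := by ring

/-! ### The Fourier–Laplace transform -/

/-- The tempered distribution `u = T ∘ 𝓕⁻¹` (so that `𝓕u = T` in the sense `u(𝓕φ) = T(φ)`).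
[folklore] -/
def fourierInvDual (T : 𝓢(EuclideanSpace ℝ ι, ℂ) →L[ℂ] ℂ) : 𝓢(EuclideanSpace ℝ ι, ℂ) →L[ℂ] ℂ :=
  T.comp (FourierTransform.fourierInvCLM ℂ 𝓢(EuclideanSpace ℝ ι, ℂ))

/-- `u(𝓕φ) = T(φ)`. [folklore] -/
theorem fourierInvDual_fourier (T : 𝓢(EuclideanSpace ℝ ι, ℂ) →L[ℂ] ℂ)
    (φ : 𝓢(EuclideanSpace ℝ ι, ℂ)) : fourierInvDual T (𝓕 φ) = T φ := by
  simp [fourierInvDual]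

/-- **`u` is supported in `S`** when `T` annihilates test functions whose Fourier transform is
supported off `S`: `u(ψ) = 0` whenever `tsupport ψ` is disjoint from `S`. [folklore] -/
theorem fourierInvDual_eq_zero {T : 𝓢(EuclideanSpace ℝ ι, ℂ) →L[ℂ] ℂ} {S : Set (EuclideanSpace ℝ ι)}
    (hT : ∀ φ : 𝓢(EuclideanSpace ℝ ι, ℂ),
      Disjoint (tsupport (⇑(SchwartzMap.fourierTransformCLM ℂ φ))) S → T φ = 0)
    {ψ : 𝓢(EuclideanSpace ℝ ι, ℂ)} (hψ : Disjoint (tsupport (⇑ψ)) S) :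
    fourierInvDual T ψ = 0 := by
  have h := hT (𝓕⁻ ψ)
  rw [fourierTransformCLM_apply, FourierTransform.fourier_fourierInv_eq] at h
  simpa [fourierInvDual] using h hψ

/-- **The Fourier–Laplace transform** of `T` relative to the cone `S`:
`F(z) = u(χ_S e^{−2πi⟨z, ·⟩})`, `u = T ∘ 𝓕⁻¹` (Hörmander (1990), Thm. 7.4.2, eq. (7.4.3),
"`û(ζ) = û_φ(ζ) = ⟨u, φ e^{−i⟨·, ζ⟩}⟩`" with a cutoff `φ`; Streater–Wightman (1964), (2-62)
`ℒ(T) = ℱ(e^{−p·η} T)`), set to `0` off the tube `{Im z ∈ interior S⁻}`.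
[cite: HormanderALPDO1, Thm 7.4.2 eq (7.4.3)] -/
def fourierLaplaceFun (T : 𝓢(EuclideanSpace ℝ ι, ℂ) →L[ℂ] ℂ) (S : Set (EuclideanSpace ℝ ι)) :
    (ι → ℂ) → ℂ :=
  fun z => fourierInvDual T (laplaceKernel S z)

/-- Unfolding. [folklore] -/
theorem fourierLaplaceFun_apply (T : 𝓢(EuclideanSpace ℝ ι, ℂ) →L[ℂ] ℂ)
    (S : Set (EuclideanSpace ℝ ι)) (z : ι → ℂ) :
    fourierLaplaceFun T S z = fourierInvDual T (laplaceKernel S z) := rfl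

end Literature.Analysis.Distribution
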